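import Literature.Probability.RandomPlanarGeometry.DrivingCapacitySampling
import HarnessLib

/-!
# The germ filtration of a capacity-sampled driving function and its canonical truncation

Topic `Probability/RandomPlanarGeometry`, sub-namespace `SkorokhodEmbedding` (companion of
`DrivingCapacitySampling.lean` and `DrivingConvergenceEngine.lean`). Everything here is PROVED; no
named fact is introduced.

Lawler–Schramm–Werner (2004), §3.3, feed their driving-convergence engine (the tree's
`RawDrivingData.IsValid`, `exists_delta_forall_coupling_lt`) with a finite filtered probability
space: histories `H k`, capacities and driving values sampled at the stopping indices and adapted
to `H k`, and the two conditional-moment ("key") estimates atom by atom. For a finite family of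
continuous paths `drv ω` read through the capacity sampling `capStop` of
`DrivingCapacitySampling.lean`, this file manufactures ALL of that structure canonically, so that
the only genuine input left is probabilistic:

* `germAtom drv δ k ω` — the **germ atom** of `ω` at step `k`: the samples whose path agrees with
  `drv ω` on `[0, capStop (drv ω) δ k]`. Germ atoms are the classes of an equivalence relation
  (`germAtom_eq_of_mem`, by the locality `capStop_congr` of the sampling) and refine as `k` grows
  (`germAtom_subset_of_le`).
* `setCode Ω : Set Ω → ℕ` — an injective (for finite `Ω`) coding of subsets, and the **germ
  histories** `germHist drv δ k ω := setCode Ω (germAtom drv δ k ω)` with label type `ℕ`: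
  refining, and determining the path up to the current stopping capacity BY DEFINITION.
* `germViol P drv δ κ C₁ C₂ k ω` — the germ atom of `ω` at step `k` **violates** one of the two
  key bounds `|∫_A ΔW| ≤ C₁ δ³ P(A)`, `|∫_A ((ΔW)² - κ Δt)| ≤ C₂ δ³ P(A)` (untruncated increments
  of the sampled path between the `k`-th and `(k+1)`-st stopping capacities).
* `germTrunc … N ω` — the **canonical truncation index**: the first `k ≤ N` whose germ atom
  violates (or `N`). It is adapted to the germ histories (`min_germTrunc_eq_of_mem`), and
  `germTrunc … N ω < N ↔ ∃ k < N, germViol … k ω` (`germTrunc_lt_iff`).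
* `germ_sampledData_isValid` — **the sampled data with germ histories and canonical truncation are
  valid raw driving data** (`RawDrivingData.IsValid N`) as soon as `P` is a probability law on a
  finite space, `0 < δ`, `C₁ δ² ≤ 1`, `κ, C₁, C₂ ≥ 0` and every path starts at `0`: live atoms
  satisfy the key bounds by definition of the truncation, frozen atoms have zero increments.
  Together with `sampledData_lowerFailSet_subset` (the lower bound fails only on `{τ < N}`) this
  reduces the input of the engine to the single probabilistic statement
  `P {∃ k < N, germViol … k} → 0`.

## References

* G. F. Lawler, O. Schramm, W. Werner, *Conformal invariance of planar loop-erased random walks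
  and uniform spanning trees*, Ann. Probab. 32 (2004), §3.3 (proof of Thm. 3.7) and proof of
  Thm. 4.4 [LawlerSchrammWerner2004].
-/

noncomputable section

open MeasureTheory Filter Set
open scoped NNReal Topology

namespace Literature.Probability.RandomPlanarGeometry.SkorokhodEmbedding

/-! ### Germ atoms -/

section Germ

variable {Ω : Type} (drv : Ω → C(ℝ≥0, ℝ)) (δ : ℝ)

/-- The **germ atom** of `ω` at step `k`: the samples whose path agrees with the path of `ω` up to
the `k`-th stopping capacity of `ω` (the atom of the filtration generated by the sampled path).
[folklore] -/
def germAtom (k : ℕ) (ω : Ω) : Set Ω :=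
  {ω' | ∀ u ≤ capStop (drv ω) δ k, drv ω' u = drv ω u}

variable {drv δ}

/-- Membership in a germ atom. [folklore] -/
theorem mem_germAtom {k : ℕ} {ω ω' : Ω} :
    ω' ∈ germAtom drv δ k ω ↔ ∀ u ≤ capStop (drv ω) δ k, drv ω' u = drv ω u := Iff.rfl

/-- Every sample lies in its own germ atom. [folklore] -/
theorem mem_germAtom_self (k : ℕ) (ω : Ω) : ω ∈ germAtom drv δ k ω := fun _ _ ↦ rfl

/-- Two samples in the same germ atom have the same stopping capacities up to that step
(locality of the sampling, `capStop_congr`). [folklore] -/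
theorem capStop_eq_of_mem_germAtom {k : ℕ} {ω ω' : Ω} (h : ω' ∈ germAtom drv δ k ω) :
    ∀ j ≤ k, capStop (drv ω') δ j = capStop (drv ω) δ j :=
  capStop_congr (drv ω) δ h le_rfl

/-- **Germ atoms are equivalence classes**: the germ atom of a member is the atom itself. [folklore] -/
theorem germAtom_eq_of_mem {k : ℕ} {ω ω' : Ω} (h : ω' ∈ germAtom drv δ k ω) :
    germAtom drv δ k ω' = germAtom drv δ k ω := by
  have hcap : capStop (drv ω') δ k = capStop (drv ω) δ k := capStop_eq_of_mem_germAtom h k le_rfl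
  ext ω''
  simp only [mem_germAtom, hcap]
  constructor
  · intro h'' u hu; rw [h'' u hu, h u hu]
  · intro h'' u hu; rw [h'' u hu, h u hu]

/-- Germ atoms refine: the atom at step `k` is contained in the atom at every earlier step.
[folklore] -/
theorem germAtom_subset_of_le {j k : ℕ} (hjk : j ≤ k) (ω : Ω) :
    germAtom drv δ k ω ⊆ germAtom drv δ j ω := fun _ h u hu ↦
  h u (hu.trans (monotone_capStop (drv ω) δ hjk))

end Germ

/-! ### Coding subsets by natural numbers -/

section Code

/-- A coding of the subsets of a type by natural numbers, injective when the type is finite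
(chosen once and for all; junk otherwise). [folklore] -/
theorem exists_setCode (Ω : Type) : ∃ f : Set Ω → ℕ, Finite Ω → Function.Injective f := by
  by_cases h : Finite Ω
  · haveI := h
    haveI : Countable (Set Ω) := inferInstance
    obtain ⟨f, hf⟩ := exists_injective_nat (Set Ω)
    exact ⟨f, fun _ ↦ hf⟩
  · exact ⟨fun _ ↦ 0, fun h' ↦ absurd h' h⟩

/-- The chosen coding `Set Ω → ℕ`. [folklore] -/
def setCode (Ω : Type) : Set Ω → ℕ := (exists_setCode Ω).choose

/-- On a finite type the coding of subsets is injective. [folklore] -/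
theorem setCode_injective (Ω : Type) [Finite Ω] : Function.Injective (setCode Ω) :=
  (exists_setCode Ω).choose_spec ‹_›

end Code

/-! ### Germ histories -/

section Hist

variable {Ω : Type} (drv : Ω → C(ℝ≥0, ℝ)) (δ : ℝ)

/-- The **germ history** at step `k`: the code of the germ atom (label type `ℕ`). [folklore] -/
def germHist (k : ℕ) (ω : Ω) : ℕ := setCode Ω (germAtom drv δ k ω)

variable {drv δ}

/-- On a finite space two samples have the same germ history iff the second lies in the germ atom
of the first. [folklore] -/
theorem germHist_eq_iff [Finite Ω] {k : ℕ} {ω ω' : Ω} :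
    germHist drv δ k ω = germHist drv δ k ω' ↔ ω' ∈ germAtom drv δ k ω := by
  unfold germHist
  constructor
  · intro h
    have hA : germAtom drv δ k ω = germAtom drv δ k ω' := setCode_injective Ω h
    rw [hA]; exact mem_germAtom_self k ω'
  · intro h; rw [germAtom_eq_of_mem h]

/-- **Germ histories refine.** [folklore] -/
theorem germHist_refine [Finite Ω] ⦃k n : ℕ⦄ ⦃ω ω' : Ω⦄ (hkn : k ≤ n)
    (h : germHist drv δ n ω = germHist drv δ n ω') : germHist drv δ k ω = germHist drv δ k ω' :=
  germHist_eq_iff.2 (germAtom_subset_of_le hkn ω (germHist_eq_iff.1 h))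

/-- **Germ histories determine the path up to the current stopping capacity** (by definition).
[folklore] -/
theorem drv_eq_of_germHist_eq [Finite Ω] {k : ℕ} {ω ω' : Ω}
    (h : germHist drv δ k ω = germHist drv δ k ω') :
    ∀ u ≤ capStop (drv ω) δ k, drv ω' u = drv ω u :=
  germHist_eq_iff.1 h

end Hist

/-! ### Violating atoms and the canonical truncation -/

section Trunc

variable {Ω : Type} [MeasurableSpace Ω] (P : Measure Ω) (drv : Ω → C(ℝ≥0, ℝ)) (δ κ C₁ C₂ : ℝ)

/-- The germ atom of `ω` at step `k` **violates a key bound**: the integral over the atom of the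
driving increment between the `k`-th and `(k+1)`-st stopping capacities exceeds `C₁ δ³ P(atom)` in
absolute value, or that of `(ΔW)² - κ Δt` exceeds `C₂ δ³ P(atom)` ([LSW04] Prop. 3.4 read along
§3.3's stopping indices, negated). [cite: LawlerSchrammWerner2004, Theorem 3.7] -/
def germViol (k : ℕ) (ω : Ω) : Prop :=
  C₁ * δ ^ 3 * P.real (germAtom drv δ k ω) <
      |∫ ω' in germAtom drv δ k ω,
        (drv ω' (capStop (drv ω') δ (k + 1)) - drv ω' (capStop (drv ω') δ k)) ∂P| ∨
    C₂ * δ ^ 3 * P.real (germAtom drv δ k ω) <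
      |∫ ω' in germAtom drv δ k ω,
        ((drv ω' (capStop (drv ω') δ (k + 1)) - drv ω' (capStop (drv ω') δ k)) ^ 2 -
          κ * ((capStop (drv ω') δ (k + 1) : ℝ) - (capStop (drv ω') δ k : ℝ))) ∂P|

open Classical in
/-- The **canonical truncation index** up to the horizon `N`: the first step `k` with `k = N` or
whose germ atom violates a key bound (the data are frozen from there on, as in the proof of
[LSW04] Thm. 4.4). [cite: LawlerSchrammWerner2004, Theorem 3.7] -/
def germTrunc (N : ℕ) (ω : Ω) : ℕ :=
  Nat.find (⟨N, Or.inl rfl⟩ : ∃ k, k = N ∨ germViol P drv δ κ C₁ C₂ k ω)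

variable {P drv δ κ C₁ C₂}

/-- Violation depends only on the germ atom. [folklore] -/
theorem germViol_congr {k : ℕ} {ω ω' : Ω} (h : germAtom drv δ k ω' = germAtom drv δ k ω) :
    germViol P drv δ κ C₁ C₂ k ω' ↔ germViol P drv δ κ C₁ C₂ k ω := by
  simp only [germViol, h]

/-- The truncation index is at most the horizon. [folklore] -/
theorem germTrunc_le (N : ℕ) (ω : Ω) : germTrunc P drv δ κ C₁ C₂ N ω ≤ N := by
  classical
  exact Nat.find_min' _ (Or.inl rfl)

/-- Before the truncation index no germ atom violates, and the horizon is not reached. [folklore] -/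
theorem not_germViol_of_lt_germTrunc {N k : ℕ} {ω : Ω} (hk : k < germTrunc P drv δ κ C₁ C₂ N ω) :
    k < N ∧ ¬ germViol P drv δ κ C₁ C₂ k ω := by
  classical
  have h := Nat.find_min _ hk
  push Not at h
  exact ⟨lt_of_le_of_ne (hk.le.trans (germTrunc_le N ω)) h.1, h.2⟩

/-- **Truncation before the horizon happens exactly on the violation event.** [folklore] -/
theorem germTrunc_lt_iff {N : ℕ} {ω : Ω} :
    germTrunc P drv δ κ C₁ C₂ N ω < N ↔ ∃ k < N, germViol P drv δ κ C₁ C₂ k ω := by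
  classical
  constructor
  · intro h
    have hspec : germTrunc P drv δ κ C₁ C₂ N ω = N ∨ germViol P drv δ κ C₁ C₂ (germTrunc P drv δ κ C₁ C₂ N ω) ω :=
      Nat.find_spec (⟨N, Or.inl rfl⟩ : ∃ k, k = N ∨ germViol P drv δ κ C₁ C₂ k ω)
    rcases hspec with h' | h'
    · exact absurd h' h.ne
    · exact ⟨_, h, h'⟩
  · rintro ⟨k, hk, hv⟩
    exact lt_of_le_of_lt (Nat.find_min' _ (Or.inr hv)) hk

/-- The violation event as a set. [folklore] -/
theorem setOf_germTrunc_lt (N : ℕ) :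
    {ω | germTrunc P drv δ κ C₁ C₂ N ω < N} = {ω | ∃ k < N, germViol P drv δ κ C₁ C₂ k ω} :=
  Set.ext fun _ ↦ germTrunc_lt_iff

/-- **The truncation index is adapted to the germ atoms**: two samples in the same germ atom at
step `k` are truncated at the same index if either is truncated by step `k`, and otherwise both
survive step `k`. [folklore] -/
theorem germTrunc_eq_or_lt_of_mem {N k : ℕ} {ω ω' : Ω} (h : ω' ∈ germAtom drv δ k ω) :
    (germTrunc P drv δ κ C₁ C₂ N ω' = germTrunc P drv δ κ C₁ C₂ N ω ∧
        germTrunc P drv δ κ C₁ C₂ N ω ≤ k) ∨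
      (k < germTrunc P drv δ κ C₁ C₂ N ω ∧ k < germTrunc P drv δ κ C₁ C₂ N ω') := by
  classical
  -- the defining predicates agree up to step `k`
  have hQ : ∀ j ≤ k, ((j = N ∨ germViol P drv δ κ C₁ C₂ j ω') ↔ (j = N ∨ germViol P drv δ κ C₁ C₂ j ω)) := by
    intro j hj
    have hmem : ω' ∈ germAtom drv δ j ω := germAtom_subset_of_le hj ω h
    rw [germViol_congr (germAtom_eq_of_mem hmem)]
  set τ := germTrunc P drv δ κ C₁ C₂ N ω with hτ
  set τ' := germTrunc P drv δ κ C₁ C₂ N ω' with hτ'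
  by_cases hle : τ ≤ k
  · left
    refine ⟨le_antisymm ?_ ?_, hle⟩
    · -- `τ' ≤ τ`: the predicate holds for `ω` at `τ`, hence for `ω'`
      have hspec : τ = N ∨ germViol P drv δ κ C₁ C₂ τ ω :=
        Nat.find_spec (⟨N, Or.inl rfl⟩ : ∃ k, k = N ∨ germViol P drv δ κ C₁ C₂ k ω)
      exact Nat.find_min' _ ((hQ τ hle).2 hspec)
    · -- `τ ≤ τ'`: below `τ' ∧ …` nothing holds for `ω'`; if `τ' < τ ≤ k` we get a contradiction
      by_contra hlt
      push Not at hlt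
      have hspec' : τ' = N ∨ germViol P drv δ κ C₁ C₂ τ' ω' :=
        Nat.find_spec (⟨N, Or.inl rfl⟩ : ∃ k, k = N ∨ germViol P drv δ κ C₁ C₂ k ω')
      have := (hQ τ' (hlt.le.trans hle)).1 hspec'
      exact absurd (Nat.find_min' (⟨N, Or.inl rfl⟩ : ∃ k, k = N ∨ germViol P drv δ κ C₁ C₂ k ω) this)
        (not_le.2 hlt)
  · right
    push Not at hle
    refine ⟨hle, ?_⟩
    by_contra hle'
    push Not at hle'
    have hspec' : τ' = N ∨ germViol P drv δ κ C₁ C₂ τ' ω' :=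
      Nat.find_spec (⟨N, Or.inl rfl⟩ : ∃ k, k = N ∨ germViol P drv δ κ C₁ C₂ k ω')
    have := (hQ τ' hle').1 hspec'
    exact absurd (Nat.find_min' (⟨N, Or.inl rfl⟩ : ∃ k, k = N ∨ germViol P drv δ κ C₁ C₂ k ω) this)
      (not_le.2 (lt_of_le_of_lt hle' hle))

/-- Adaptedness of the truncated step index `k ∧ τ` (hypothesis `hτ` of `sampledData_isValid`).
[folklore] -/
theorem min_germTrunc_eq_of_mem {N k : ℕ} {ω ω' : Ω} (h : ω' ∈ germAtom drv δ k ω) :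
    min k (germTrunc P drv δ κ C₁ C₂ N ω) = min k (germTrunc P drv δ κ C₁ C₂ N ω') := by
  rcases germTrunc_eq_or_lt_of_mem (P := P) (κ := κ) (C₁ := C₁) (C₂ := C₂) (N := N) h with
    ⟨he, -⟩ | ⟨h1, h2⟩
  · rw [he]
  · rw [min_eq_left h1.le, min_eq_left h2.le]

/-- Adaptedness one step further: `(k+1) ∧ τ` is also determined by the germ atom at step `k`.
[folklore] -/
theorem min_succ_germTrunc_eq_of_mem {N k : ℕ} {ω ω' : Ω} (h : ω' ∈ germAtom drv δ k ω) :
    min (k + 1) (germTrunc P drv δ κ C₁ C₂ N ω) = min (k + 1) (germTrunc P drv δ κ C₁ C₂ N ω') := by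
  rcases germTrunc_eq_or_lt_of_mem (P := P) (κ := κ) (C₁ := C₁) (C₂ := C₂) (N := N) h with
    ⟨he, -⟩ | ⟨h1, h2⟩
  · rw [he]
  · rw [min_eq_left (Nat.succ_le_of_lt h1), min_eq_left (Nat.succ_le_of_lt h2)]

end Trunc

/-! ### Validity of the germ-sampled data -/

section Valid

variable {Ω : Type} [Fintype Ω] [MeasurableSpace Ω] [MeasurableSingletonClass Ω]
  {P : Measure Ω} {drv : Ω → C(ℝ≥0, ℝ)} {δ κ C₁ C₂ : ℝ} {N : ℕ}

omit [MeasurableSingletonClass Ω] in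
/-- The history atom of the germ-sampled data with label `germHist drv δ k ω₀` is the germ atom of
`ω₀`, as a finite set. [folklore] -/
theorem coe_atom_germHist (τ : Ω → ℕ) (k : ℕ) (ω₀ : Ω) :
    ((sampledData P (germHist drv δ) drv τ δ κ C₁ C₂).base.atom k (germHist drv δ k ω₀) : Set Ω) =
      germAtom drv δ k ω₀ := by
  ext ω
  rw [Finset.mem_coe, MartingaleData.mem_atom]
  change germHist drv δ k ω = germHist drv δ k ω₀ ↔ ω ∈ germAtom drv δ k ω₀
  rw [eq_comm]
  exact germHist_eq_iff

/-- On a non-violating germ atom the conditional mean of an integrand whose atom integral obeys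
`|∫_A f| ≤ c P(A)` is at most `c` in absolute value. [folklore] -/
theorem abs_condMean_le_of_integral_le [IsFiniteMeasure P] (τ : Ω → ℕ) {k : ℕ} {ω₀ : Ω}
    {f : Ω → ℝ} {c : ℝ} (hc : 0 ≤ c)
    (hf : |∫ ω in germAtom drv δ k ω₀, f ω ∂P| ≤ c * P.real (germAtom drv δ k ω₀)) :
    |(sampledData P (germHist drv δ) drv τ δ κ C₁ C₂).base.condMean k f (germHist drv δ k ω₀)| ≤ c := by
  set R := sampledData P (germHist drv δ) drv τ δ κ C₁ C₂ with hR
  have hA := coe_atom_germHist (P := P) (drv := drv) (δ := δ) (κ := κ) (C₁ := C₁) (C₂ := C₂) τ k ω₀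
  have hsum : ∑ ω ∈ R.base.atom k (germHist drv δ k ω₀), P.real {ω} * f ω =
      ∫ ω in germAtom drv δ k ω₀, f ω ∂P := by
    rw [← hA, setIntegral_eq_sum_finset]
  have hpH : R.base.pH k (germHist drv δ k ω₀) = P.real (germAtom drv δ k ω₀) := by
    rw [← hA]
    change ∑ ω ∈ R.base.atom k (germHist drv δ k ω₀), P.real {ω} = _
    exact sum_measureReal_singleton _
  change |(∑ ω ∈ R.base.atom k (germHist drv δ k ω₀), R.base.P.real {ω} * f ω) /
    R.base.pH k (germHist drv δ k ω₀)| ≤ c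
  have hP : R.base.P = P := rfl
  rw [hP, hsum, hpH]
  by_cases h0 : P.real (germAtom drv δ k ω₀) = 0
  · rw [h0, div_zero, abs_zero]; exact hc
  · have hpos : 0 < P.real (germAtom drv δ k ω₀) := lt_of_le_of_ne measureReal_nonneg (Ne.symm h0)
    rw [abs_div, abs_of_pos hpos, div_le_iff₀ hpos]
    exact hf

omit [MeasurableSingletonClass Ω] in
/-- The conditional mean over an EMPTY history atom (a label that is not a germ code) vanishes.
[folklore] -/
theorem condMean_eq_zero_of_forall_ne (τ : Ω → ℕ) {k : ℕ} {l : ℕ} (f : Ω → ℝ)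
    (hl : ∀ ω, germHist drv δ k ω ≠ l) :
    (sampledData P (germHist drv δ) drv τ δ κ C₁ C₂).base.condMean k f l = 0 := by
  have hempty : (sampledData P (germHist drv δ) drv τ δ κ C₁ C₂).base.atom k l = ∅ := by
    ext ω
    simp only [MartingaleData.mem_atom, Finset.notMem_empty, iff_false]
    exact hl ω
  change (∑ ω ∈ (sampledData P (germHist drv δ) drv τ δ κ C₁ C₂).base.atom k l, _) / _ = 0
  rw [hempty, Finset.sum_empty, zero_div]

/-- **The germ-sampled data with the canonical truncation are valid raw driving data** up to the
horizon `N` ([LSW04] §3.3 with the freezing of the proof of Thm. 4.4): on a finite probability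
space, for `0 < δ`, `C₁ δ² ≤ 1`, `κ, C₁, C₂ ≥ 0` and paths starting at `0`, the histories
`germHist` refine and determine the path up to the current stopping capacity, the truncation
`germTrunc` is adapted, live atoms satisfy the two key bounds by definition of the truncation and
frozen atoms have zero increments. [cite: LawlerSchrammWerner2004, Theorem 3.7] -/
theorem germ_sampledData_isValid (hP : IsProbabilityMeasure P) (hδ : 0 < δ) (hC₁δ : C₁ * δ ^ 2 ≤ 1)
    (hκ : 0 ≤ κ) (hC₁ : 0 ≤ C₁) (hC₂ : 0 ≤ C₂) (h0 : ∀ ω, drv ω 0 = 0) :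
    (sampledData P (germHist drv δ) drv (germTrunc P drv δ κ C₁ C₂ N) δ κ C₁ C₂).IsValid N := by
  haveI := hP
  set τ := germTrunc P drv δ κ C₁ C₂ N with hτdef
  set R := sampledData P (germHist drv δ) drv τ δ κ C₁ C₂ with hR
  -- the two conditional-moment bounds, atom by atom
  have hmom : ∀ (k : ℕ) (l : ℕ),
      |R.base.condMean k (fun ω ↦ R.dval (k + 1) ω - R.dval k ω) l| ≤ C₁ * δ ^ 3 ∧
      |R.base.condMean k (fun ω ↦ (R.dval (k + 1) ω - R.dval k ω) ^ 2 -
        κ * ((R.tcap (k + 1) ω : ℝ) - R.tcap k ω)) l| ≤ C₂ * δ ^ 3 := by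
    intro k l
    have hc₁ : 0 ≤ C₁ * δ ^ 3 := by positivity
    have hc₂ : 0 ≤ C₂ * δ ^ 3 := by positivity
    by_cases hl : ∃ ω₀, germHist drv δ k ω₀ = l
    · obtain ⟨ω₀, rfl⟩ := hl
      rcases le_or_gt (τ ω₀) k with hdead | hlive
      · -- frozen atom: every member is truncated at `τ ω₀ ≤ k`, increments vanish
        have hfr : ∀ ω ∈ germAtom drv δ k ω₀, min (k + 1) (τ ω) = min k (τ ω) := by
          intro ω hω
          rcases germTrunc_eq_or_lt_of_mem (P := P) (κ := κ) (C₁ := C₁) (C₂ := C₂) (N := N) hω with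
            ⟨he, -⟩ | ⟨h1, -⟩
          · change τ ω = τ ω₀ at he
            rw [he, min_eq_right (hdead.trans (Nat.le_succ k)), min_eq_right hdead]
          · exact absurd hdead (not_le.2 h1)
        have hz1 : ∫ ω in germAtom drv δ k ω₀, (R.dval (k + 1) ω - R.dval k ω) ∂P = 0 := by
          refine setIntegral_eq_zero_of_forall_eq_zero fun ω hω ↦ ?_
          simp only [hR, sampledData_dval, hfr ω hω, sub_self]
        have hz2 : ∫ ω in germAtom drv δ k ω₀, ((R.dval (k + 1) ω - R.dval k ω) ^ 2 -
            κ * ((R.tcap (k + 1) ω : ℝ) - R.tcap k ω)) ∂P = 0 := by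
          refine setIntegral_eq_zero_of_forall_eq_zero fun ω hω ↦ ?_
          simp only [hR, sampledData_dval, sampledData_tcap, hfr ω hω, sub_self]
          ring
        refine ⟨abs_condMean_le_of_integral_le τ hc₁ ?_, abs_condMean_le_of_integral_le τ hc₂ ?_⟩
        · rw [hz1, abs_zero]; positivity
        · rw [hz2, abs_zero]; positivity
      · -- live atom: every member survives step `k`, increments are the untruncated ones, and
        -- the atom does not violate (minimality of the truncation index)
        obtain ⟨-, hnv⟩ := not_germViol_of_lt_germTrunc hlive
        have hlv : ∀ ω ∈ germAtom drv δ k ω₀, min (k + 1) (τ ω) = k + 1 ∧ min k (τ ω) = k := by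
          intro ω hω
          rcases germTrunc_eq_or_lt_of_mem (P := P) (κ := κ) (C₁ := C₁) (C₂ := C₂) (N := N) hω with
            ⟨-, hle⟩ | ⟨-, h2⟩
          · exact absurd hle (not_le.2 hlive)
          · exact ⟨min_eq_left (Nat.succ_le_of_lt h2), min_eq_left h2.le⟩
        simp only [germViol, not_or, not_lt] at hnv
        have he1 : ∫ ω in germAtom drv δ k ω₀, (R.dval (k + 1) ω - R.dval k ω) ∂P =
            ∫ ω in germAtom drv δ k ω₀,
              (drv ω (capStop (drv ω) δ (k + 1)) - drv ω (capStop (drv ω) δ k)) ∂P := by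
          refine setIntegral_congr_fun (Set.toFinite _).measurableSet fun ω hω ↦ ?_
          simp only [hR, sampledData_dval, (hlv ω hω).1, (hlv ω hω).2]
        have he2 : ∫ ω in germAtom drv δ k ω₀, ((R.dval (k + 1) ω - R.dval k ω) ^ 2 -
            κ * ((R.tcap (k + 1) ω : ℝ) - R.tcap k ω)) ∂P =
            ∫ ω in germAtom drv δ k ω₀,
              ((drv ω (capStop (drv ω) δ (k + 1)) - drv ω (capStop (drv ω) δ k)) ^ 2 -
                κ * ((capStop (drv ω) δ (k + 1) : ℝ) - (capStop (drv ω) δ k : ℝ))) ∂P := by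
          refine setIntegral_congr_fun (Set.toFinite _).measurableSet fun ω hω ↦ ?_
          simp only [hR, sampledData_dval, sampledData_tcap, (hlv ω hω).1, (hlv ω hω).2]
        refine ⟨abs_condMean_le_of_integral_le τ hc₁ ?_, abs_condMean_le_of_integral_le τ hc₂ ?_⟩
        · rw [he1]; exact hnv.1
        · rw [he2]; exact hnv.2
    · push Not at hl
      rw [condMean_eq_zero_of_forall_ne τ _ hl, condMean_eq_zero_of_forall_ne τ _ hl, abs_zero]
      exact ⟨hc₁, hc₂⟩
  refine sampledData_isValid hP (fun k n ω ω' hkn h ↦ germHist_refine hkn h) hδ hC₁δ hκ hC₁ hC₂ h0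
    ?_ ?_ (fun k l ↦ (hmom k l).1) (fun k _ l ↦ (hmom k l).2)
  · -- the history determines the path up to the current (truncated) stopping capacity
    intro k ω ω' h u hu
    exact drv_eq_of_germHist_eq h u (hu.trans (monotone_capStop (drv ω) δ (min_le_left _ _)))
  · -- the truncated step index is adapted
    intro k ω ω' h
    exact min_germTrunc_eq_of_mem (germHist_eq_iff.1 h)

omit [Fintype Ω] [MeasurableSingletonClass Ω] in
/-- **What the engine charges**: for the germ-sampled data with canonical truncation, the failure
event of the lower bound `(ΔW)² + Δt ≥ δ²` before the horizon is contained in the violation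
event `{∃ k < N, germViol … k}` (`sampledData_lowerFailSet_subset` and `germTrunc_lt_iff`).
[cite: LawlerSchrammWerner2004, Theorem 3.7] -/
theorem germ_lowerFailSet_subset (hδ : 0 ≤ δ) :
    {ω | ∃ k < N,
        ((sampledData P (germHist drv δ) drv (germTrunc P drv δ κ C₁ C₂ N) δ κ C₁ C₂).dval (k + 1) ω -
            (sampledData P (germHist drv δ) drv (germTrunc P drv δ κ C₁ C₂ N) δ κ C₁ C₂).dval k ω) ^ 2 +
          (((sampledData P (germHist drv δ) drv (germTrunc P drv δ κ C₁ C₂ N) δ κ C₁ C₂).tcap (k + 1) ω : ℝ) -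
            (sampledData P (germHist drv δ) drv (germTrunc P drv δ κ C₁ C₂ N) δ κ C₁ C₂).tcap k ω) <
        (sampledData P (germHist drv δ) drv (germTrunc P drv δ κ C₁ C₂ N) δ κ C₁ C₂).δ ^ 2} ⊆
      {ω | ∃ k < N, germViol P drv δ κ C₁ C₂ k ω} := by
  rw [← setOf_germTrunc_lt]
  exact sampledData_lowerFailSet_subset hδ N

end Valid

end Literature.Probability.RandomPlanarGeometry.SkorokhodEmbedding

end
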